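import Literature.NumberTheory.EllipticCurves.LocalIndexBadPoints
import HarnessLib

/-!
# Bad points of the type-`IV` normal form: coordinates, negation, same-label sums

Computations with `K`-points of an equation `J` over a discrete valuation ring `R` in the normal
form of type `IV` (`a₁ = πα`, `a₂ = πβ`, `a₃ = πγ`, `a₄ = π²δ`, `a₆ = π²ε`; Silverman, *ATAEC*,
IV.9.4 Step 5), used by `NeronComponentIndexTypeIVProofs.lean` to prove `c_v ∈ {1, 3}`:

* `exists_eq_some_of_not_hasNonsingularReduction_IV`: a bad point is `(πx₁, πy₁)` with
  `ȳ₁² + γ̄ȳ₁ − ε̄ = 0` (the equation divided by `π²`);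
* `neg_eq_some_IV`: `−(πx₁, πy₁) = (πx₁, π(−y₁ − παx₁ − γ))` — the label `ȳ₁` goes to the other
  root `−ȳ₁ − γ̄`;
* `add_eq_some_IV`: two bad points with the same label `ȳ₁ = ȳ₁'`, a simple root, add up to
  `(πX, πY)` with `Ȳ = −ȳ₁ − γ̄`: the slope is `λ = N/D` (`slope_mul_eq`) with `D = π·unit`,
  `π² ∣ N`, so `λ ∈ 𝔪`, and the chord formulas are explicit;
* two small facts on separable quadratics (`root_quadratic_eq_or`,
  `two_mul_add_ne_zero_of_root`).

## References

* J. H. Silverman, *Advanced Topics in the Arithmetic of Elliptic Curves*, GTM 151, Springer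
  1994, IV.9.4 Step 5 (PDF p. 344) and its proof (PDF pp. 348–349). [SilvermanATAEC1994]
-/

noncomputable section

open scoped Classical

open IsLocalRing

namespace Literature.NumberTheory.EllipticCurves

namespace LocalIndex

open DiophantineGeometry DiophantineGeometry.TateAlgorithm

variable {R : Type*} [CommRing R] [IsDomain R] [IsDiscreteValuationRing R]

/-! ### Bad points: coordinates, labels, negation, same-label sums -/

variable {K : Type*} [Field K] [Algebra R K] [IsFractionRing R K]

/-- **Bad points of the `IV` normal form.** With `a₁ = πα`, `a₂ = πβ`, `a₃ = πγ`, `a₄ = π²δ`,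
`a₆ = π²ε`, a point of `J(K)` without nonsingular reduction is `(πx₁, πy₁)` with
`y₁² + γy₁ − ε = π(x₁³ + βx₁² + δx₁ − αx₁y₁)` (the equation divided by `π²`), so `ȳ₁` is a root of
`Y² + γ̄Y − ε̄`. [cite: SilvermanATAEC1994, IV.9.4 Step 5] -/
theorem exists_eq_some_of_not_hasNonsingularReduction_IV (J : WeierstrassCurve R)
    {ϖ α β γ δ ε : R} (hϖ : Irreducible ϖ) (hα : J.a₁ = ϖ * α) (hβ : J.a₂ = ϖ * β)
    (hγ : J.a₃ = ϖ * γ) (hδ : J.a₄ = ϖ ^ 2 * δ) (hε : J.a₆ = ϖ ^ 2 * ε)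
    {P : (J.baseChange K).toAffine.Point} (hP : ¬ J.HasNonsingularReduction P) :
    ∃ (x₁ y₁ : R) (h : (J.baseChange K).toAffine.Nonsingular (algebraMap R K (ϖ * x₁))
      (algebraMap R K (ϖ * y₁))), P = .some _ _ h ∧
        y₁ ^ 2 + γ * y₁ - ε = ϖ * (x₁ ^ 3 + β * x₁ ^ 2 + δ * x₁ - α * x₁ * y₁) := by
  have hϖ0 : ϖ ≠ 0 := hϖ.ne_zero
  have hm : ϖ ∈ maximalIdeal R := (IsLocalRing.mem_maximalIdeal _).mpr hϖ.not_isUnit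
  have h3 : J.a₃ ∈ maximalIdeal R := hγ ▸ Ideal.mul_mem_right _ _ hm
  have h4 : J.a₄ ∈ maximalIdeal R :=
    hδ ▸ Ideal.mul_mem_right _ _ (Ideal.pow_mem_of_mem _ hm 2 two_pos)
  have h6 : J.a₆ ∈ maximalIdeal R :=
    hε ▸ Ideal.mul_mem_right _ _ (Ideal.pow_mem_of_mem _ hm 2 two_pos)
  obtain ⟨x, y, h, rfl, hx, hy⟩ := exists_eq_some_of_not_hasNonsingularReduction J h3 h4 h6 hP
  have he : J.toAffine.Equation x y :=
    (WeierstrassCurve.Affine.map_equation _ (IsFractionRing.injective R K) _ _).mp h.left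
  obtain ⟨x₁, rfl⟩ := (mem_maximalIdeal_iff_dvd_of_irreducible hϖ x).mp hx
  obtain ⟨y₁, rfl⟩ := (mem_maximalIdeal_iff_dvd_of_irreducible hϖ y).mp hy
  rw [WeierstrassCurve.Affine.equation_iff, hα, hβ, hγ, hδ, hε] at he
  exact ⟨x₁, y₁, h, rfl, mul_left_cancel₀ (pow_ne_zero 2 hϖ0) (by linear_combination he)⟩

/-- Two roots of a separable quadratic: if `y², r` are roots of `Y² + γ̄Y − ε̄` then `y = r` or
`y = −r − γ̄`. [folklore] -/
theorem root_quadratic_eq_or {F : Type*} [Field F] {g e y r : F} (hy : y ^ 2 + g * y - e = 0)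
    (hr : r ^ 2 + g * r - e = 0) : y = r ∨ y = -r - g := by
  have h : (y - r) * (y - (-r - g)) = 0 := by linear_combination hy - hr
  rcases mul_eq_zero.mp h with h | h
  · exact Or.inl (sub_eq_zero.mp h)
  · exact Or.inr (sub_eq_zero.mp h)

/-- A root of a separable quadratic is simple: `2r + γ̄ ≠ 0` when `γ̄² + 4ε̄ ≠ 0`, since
`(2r + γ̄)² = γ̄² + 4ε̄` for a root `r`. [folklore] -/
theorem two_mul_add_ne_zero_of_root {F : Type*} [Field F] {g e r : F}
    (hr : r ^ 2 + g * r - e = 0) (hdisc : g ^ 2 + 4 * e ≠ 0) : 2 * r + g ≠ 0 := by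
  intro h
  apply hdisc
  linear_combination (2 * r + g) * h - 4 * hr

omit [IsDomain R] [IsDiscreteValuationRing R] [IsFractionRing R K] in
/-- **Negation swaps the label** (normal form of type `IV`): `−(πx₁, πy₁) = (πx₁, π(−y₁ − παx₁ −
γ))`, whose reduced second coordinate is `−ȳ₁ − γ̄`, the other root. [folklore] -/
theorem neg_eq_some_IV (J : WeierstrassCurve R) {ϖ α γ : R} (hα : J.a₁ = ϖ * α)
    (hγ : J.a₃ = ϖ * γ) {x₁ y₁ : R}
    (h : (J.baseChange K).toAffine.Nonsingular (algebraMap R K (ϖ * x₁))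
      (algebraMap R K (ϖ * y₁))) :
    ∃ h', -WeierstrassCurve.Affine.Point.some _ _ h =
      WeierstrassCurve.Affine.Point.some (algebraMap R K (ϖ * x₁))
        (algebraMap R K (ϖ * (-y₁ - ϖ * α * x₁ - γ))) h' := by
  have hneg : (J.baseChange K).toAffine.negY (algebraMap R K (ϖ * x₁))
      (algebraMap R K (ϖ * y₁)) = algebraMap R K (ϖ * (-y₁ - ϖ * α * x₁ - γ)) := by
    rw [WeierstrassCurve.Affine.negY]
    simp only [WeierstrassCurve.baseChange, WeierstrassCurve.map_a₁, WeierstrassCurve.map_a₃,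
      hα, hγ, map_neg, map_sub, map_mul]
    ring
  refine ⟨hneg ▸ (WeierstrassCurve.Affine.nonsingular_neg _ _).mpr h, ?_⟩
  rw [WeierstrassCurve.Affine.Point.neg_some]
  exact point_some_congr rfl hneg

/-- **Two bad points with the same label add up to a bad point with the other label** (normal
form of type `IV`). For `P = (πx₁, πy₁)`, `P' = (πx₁', πy₁')` with `ȳ₁ = ȳ₁'` a simple root of
`Y² + γ̄Y − ε̄` (`2ȳ₁ + γ̄ ≠ 0`): `P + P' ≠ 𝒪`, the slope is `λ = N/D` (`slope_mul_eq`) with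
`D = π·(2ȳ₁ + γ̄ + …)` equal to `π` times a unit and `π² ∣ N`, so `λ ∈ 𝔪`, and the chord formulas
give `P + P' = (πX, πY)` with `Y ≡ −y₁ − γ (mod π)` (Silverman, *ATAEC*, IV.9.4 Step 5 with
Table 4.1: `Φ = ℤ/3ℤ`). [cite: SilvermanATAEC1994, IV.9.4 Step 5] -/
theorem add_eq_some_IV (J : WeierstrassCurve R) {ϖ α β γ δ : R} (hϖ : Irreducible ϖ)
    (hα : J.a₁ = ϖ * α) (hβ : J.a₂ = ϖ * β) (hγ : J.a₃ = ϖ * γ) (hδ : J.a₄ = ϖ ^ 2 * δ)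
    {x₁ y₁ x₁' y₁' : R} (hroot : residue R y₁ = residue R y₁')
    (hsimple : 2 * residue R y₁ + residue R γ ≠ 0)
    (h₁ : (J.baseChange K).toAffine.Nonsingular (algebraMap R K (ϖ * x₁))
      (algebraMap R K (ϖ * y₁)))
    (h₂ : (J.baseChange K).toAffine.Nonsingular (algebraMap R K (ϖ * x₁'))
      (algebraMap R K (ϖ * y₁'))) :
    ∃ (X Y : R) (h₃ : (J.baseChange K).toAffine.Nonsingular (algebraMap R K (ϖ * X))
      (algebraMap R K (ϖ * Y))),
      WeierstrassCurve.Affine.Point.some _ _ h₁ + WeierstrassCurve.Affine.Point.some _ _ h₂ =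
        WeierstrassCurve.Affine.Point.some _ _ h₃ ∧ residue R Y = -residue R y₁ - residue R γ := by
  have hϖ0 : ϖ ≠ 0 := hϖ.ne_zero
  have hinj := IsFractionRing.injective R K
  set f := algebraMap R K with hf
  have hfϖ : f ϖ ≠ 0 := (map_ne_zero_iff f hinj).mpr hϖ0
  have hres0 : residue R ϖ = 0 :=
    (residue_eq_zero_iff _).mpr ((IsLocalRing.mem_maximalIdeal _).mpr hϖ.not_isUnit)
  -- `P + P' ≠ 𝒪`
  have hxy : ¬ (f (ϖ * x₁) = f (ϖ * x₁') ∧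
      f (ϖ * y₁) = (J.baseChange K).toAffine.negY (f (ϖ * x₁')) (f (ϖ * y₁'))) := by
    rintro ⟨-, hy⟩
    rw [WeierstrassCurve.Affine.negY] at hy
    simp only [WeierstrassCurve.baseChange, WeierstrassCurve.map_a₁, WeierstrassCurve.map_a₃,
      hα, hγ, ← hf, map_mul] at hy
    have hy' : f (ϖ * (y₁ + y₁' + ϖ * α * x₁' + γ)) = 0 := by
      simp only [map_add, map_mul]; linear_combination hy
    rw [map_eq_zero_iff f hinj, mul_eq_zero] at hy'
    rcases hy' with h0 | h0
    · exact hϖ0 h0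
    · apply hsimple
      have := congrArg (residue R) h0
      simp only [map_add, map_mul, hres0, zero_mul, add_zero, map_zero, ← hroot] at this
      linear_combination this
  -- `D = ϖ d` with `d` a unit, `N = ϖ² n₀`
  set d : R := y₁ + y₁' + ϖ * α * x₁ + γ with hd
  set n₀ : R := x₁ ^ 2 + x₁ * x₁' + x₁' ^ 2 + β * (x₁ + x₁') + δ - α * y₁' with hn₀
  have hdu : IsUnit d := by
    rw [isUnit_iff_residue_ne_zero, hd]
    simp only [map_add, map_mul, hres0, zero_mul, add_zero, ← hroot]
    convert hsimple using 1; ring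
  have hLD := slope_mul_eq h₁.1 h₂.1 hxy
  have eD : f (ϖ * y₁) + f (ϖ * y₁') + (J.baseChange K).toAffine.a₁ * f (ϖ * x₁) +
      (J.baseChange K).toAffine.a₃ = f ϖ * f d := by
    simp only [WeierstrassCurve.baseChange, WeierstrassCurve.map_a₁, WeierstrassCurve.map_a₃, hα,
      hγ, hd, ← hf, map_add, map_mul]; ring
  have eN : f (ϖ * x₁) ^ 2 + f (ϖ * x₁) * f (ϖ * x₁') + f (ϖ * x₁') ^ 2 +
      (J.baseChange K).toAffine.a₂ * (f (ϖ * x₁) + f (ϖ * x₁')) + (J.baseChange K).toAffine.a₄ -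
      (J.baseChange K).toAffine.a₁ * f (ϖ * y₁') = f ϖ * (f ϖ * f n₀) := by
    simp only [WeierstrassCurve.baseChange, WeierstrassCurve.map_a₁, WeierstrassCurve.map_a₂,
      WeierstrassCurve.map_a₄, hα, hβ, hδ, hn₀, ← hf, map_add, map_sub, map_mul, map_pow]; ring
  rw [eD, eN, ← mul_assoc, mul_comm _ (f ϖ), mul_assoc] at hLD
  have hLd := mul_left_cancel₀ hfϖ hLD
  -- `λ = ϖ ℓ`
  set ℓ : R := n₀ * ↑hdu.unit⁻¹ with hℓ
  set L := (J.baseChange K).toAffine.slope (f (ϖ * x₁)) (f (ϖ * x₁')) (f (ϖ * y₁)) (f (ϖ * y₁'))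
    with hL
  have hd0 : f d ≠ 0 := (map_ne_zero_iff _ hinj).mpr hdu.ne_zero
  have hLeq : L = f (ϖ * ℓ) := by
    rw [← mul_left_inj' hd0, hLd, hℓ, ← map_mul, ← map_mul, mul_assoc, mul_assoc,
      IsUnit.val_inv_mul, mul_one]
  -- the coordinates of the sum
  set X : R := ϖ * ℓ ^ 2 + ϖ * α * ℓ - β - x₁ - x₁' with hX
  set Y : R := -(ϖ * ℓ * (X - x₁)) - y₁ - ϖ * α * X - γ with hY
  have eX : (J.baseChange K).toAffine.addX (f (ϖ * x₁)) (f (ϖ * x₁')) L = f (ϖ * X) := by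
    rw [WeierstrassCurve.Affine.addX, hLeq]
    simp only [WeierstrassCurve.baseChange, WeierstrassCurve.map_a₁, WeierstrassCurve.map_a₂, hα,
      hβ, hX, ← hf, map_add, map_sub, map_mul, map_pow]; ring
  have eY : (J.baseChange K).toAffine.addY (f (ϖ * x₁)) (f (ϖ * x₁')) (f (ϖ * y₁)) L =
      f (ϖ * Y) := by
    rw [WeierstrassCurve.Affine.addY, WeierstrassCurve.Affine.negAddY, WeierstrassCurve.Affine.negY,
      eX, hLeq]
    simp only [WeierstrassCurve.baseChange, WeierstrassCurve.map_a₁, WeierstrassCurve.map_a₃, hα,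
      hγ, hY, ← hf, map_sub, map_mul, map_neg]; ring
  refine ⟨X, Y, ?_, ?_, ?_⟩
  · have h₃ := WeierstrassCurve.Affine.nonsingular_add h₁ h₂ hxy
    rwa [eX, eY] at h₃
  · rw [WeierstrassCurve.Affine.Point.add_some hxy]
    exact point_some_congr eX eY
  · rw [hY]
    simp only [map_sub, map_neg, map_mul, hres0, zero_mul, neg_zero, zero_sub]
    ring

end LocalIndex

end Literature.NumberTheory.EllipticCurves

end
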